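import Mathlib
import Summits.NavierStokesRegularity.NavierStokesRegularity.Theorems.FilamentSkeletonRssSkeletonJ1RLiaDefectDerivSplit

/-!
# Crux `SkeletonJ1R` (stmt-NavierStokesRegularity-23610) · line `streamline_kantorovich_R` · toward stub F2-d (`LiaDefectDerivBL`, v7):
# THE STRAND INTEGRALS ALONG A POINT PATH — EXPLICIT DERIVATIVES (filament strands and the closed-form datum-line strands)

Lead `ns-fsr-lead-23610` g2, `--supports stmt-NavierStokesRegularity-23610 --as helper`.  MODEL rung, NEGATIVE side of the ladder: calculus for a
HYPOTHETICAL filament-type blow-up skeleton; nothing here is a claim about Navier–Stokes regularity; the stub and the crux stay OPEN.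

The residual `R = c_j A_j − β T×T′ + Σ_{k≠j} c_k (A_k − B_k)` of `…LiaDefectDerivResidual` is differentiated along the reference piece by piece:
* `hasDerivAt_strand_comp` — the regularised Biot–Savart strand `A(y) = ∫ K₃(y − X σ)•X′σ × (y − X σ) dσ` of a fixed `C¹` proper filament `X`
  along a differentiable point path `y`: derivative `∫ [(−3⟪y − Xσ, y′⟫K₅)•X′σ × (y − Xσ) + K₃•X′σ × y′] dσ` (matched toolkit + chain rule);
* `lorentzStrand_pos`, `hasDerivAt_lorentzStrand_comp` — the datum-line strand in closed form `L(y) = (2/q(y))•t × (y − w)`,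
  `q(y) = ‖y − w‖² − ⟪y − w, t⟫² + a₀ ≥ a₀ > 0` (`‖t‖ = 1`), along a path: derivative
  `(−2(2⟪y − w, y′⟫ − 2⟪y − w, t⟫⟪y′, t⟫)/q²)•t × (y − w) + (2/q)•t × y′`;
* `hasDerivAt_datumStrand_comp` — the datum-line strand integral `B_k(y τ')` equals the Lorentzian along the path, hence has that derivative.
-/

set_option linter.dupNamespace false -- `NavierStokesRegularity.NavierStokesRegularity` path/namespace repetition is the tree convention

noncomputable section

namespace Summit.NavierStokesRegularity.NavierStokesRegularity.Theorems.SkeletonJ1RFrame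

open Set Function Filter MeasureTheory Real Topology
open Literature.Analysis.FluidPDE
open Summit.NavierStokesRegularity.NavierStokesRegularity.Theorems.MatchedKernel
open scoped InnerProductSpace BigOperators

/-! ## §1 Filament strands along a point path -/

/-- **A regularised Biot–Savart strand of a fixed `C¹` proper filament along a differentiable point path**, explicit derivative. [folklore] -/
theorem hasDerivAt_strand_comp {c C : ℝ} {X : ℝ → EuclideanSpace ℝ (Fin 3)} (hc : 0 < c) (hX : ContDiff ℝ 1 X)
    (hX1 : ∀ σ, ‖deriv X σ‖ ≤ 1) (hXg : ∀ σ, c * |σ| - C ≤ ‖X σ‖) {y : ℝ → EuclideanSpace ℝ (Fin 3)} {y' : EuclideanSpace ℝ (Fin 3)}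
    {τ : ℝ} (hy : HasDerivAt y y' τ) :
    HasDerivAt (fun τ' => ∫ σ : ℝ, ((‖y τ' - X σ‖ ^ 2 + Real.exp (-(1 + Real.eulerMascheroniConstant - Real.log 2)) * (1:ℝ)) ^ (3 / 2 : ℝ))⁻¹ •
        cross (deriv X σ) (y τ' - X σ))
      (∫ σ : ℝ, ((-3 * ⟪y τ - X σ, y'⟫_ℝ *
            ((‖y τ - X σ‖ ^ 2 + Real.exp (-(1 + Real.eulerMascheroniConstant - Real.log 2)) * (1:ℝ)) ^ (5 / 2 : ℝ))⁻¹) •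
          cross (deriv X σ) (y τ - X σ) +
        ((‖y τ - X σ‖ ^ 2 + Real.exp (-(1 + Real.eulerMascheroniConstant - Real.log 2)) * (1:ℝ)) ^ (3 / 2 : ℝ))⁻¹ •
          cross (deriv X σ) y')) τ := by
  have hκ : 0 < Real.exp (-(1 + Real.eulerMascheroniConstant - Real.log 2)) * (1:ℝ) := by positivity
  have hdiff := matchedBiotSavart_differentiable (m := fun _ => Real.exp (-(1 + Real.eulerMascheroniConstant - Real.log 2)) * (1:ℝ))
    hκ (fun _ => le_rfl) continuous_const hc hX hX1 hXg
  have h := (hdiff (y τ)).hasFDerivAt.comp_hasDerivAt τ hy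
  rw [matchedBiotSavart_fderiv_apply_eq (m := fun _ => Real.exp (-(1 + Real.eulerMascheroniConstant - Real.log 2)) * (1:ℝ))
    hκ (fun _ => le_rfl) continuous_const hc hX hX1 hXg (y τ) y'] at h
  exact h

/-! ## §2 The datum-line strands in closed form along a point path -/

/-- The Lorentzian denominator is positive: `‖v‖² − ⟪v, t⟫² + a > 0` for `‖t‖ = 1`, `a > 0`. [folklore] -/
theorem lorentzStrand_pos {a : ℝ} (ha : 0 < a) (t v : EuclideanSpace ℝ (Fin 3)) (ht : ‖t‖ = 1) :
    0 < ‖v‖ ^ 2 - ⟪v, t⟫_ℝ ^ 2 + a := by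
  have h1 : |⟪v, t⟫_ℝ| ≤ ‖v‖ := by
    have := abs_real_inner_le_norm v t; rwa [ht, mul_one] at this
  have h2 : ⟪v, t⟫_ℝ ^ 2 ≤ ‖v‖ ^ 2 := by
    rw [← sq_abs]; exact pow_le_pow_left₀ (abs_nonneg _) h1 2
  linarith

/-- **The closed-form datum-line strand along a differentiable point path**, explicit derivative:
`d/dτ [(2/q)•t × (y − w)] = (−2·q′/q²)•t × (y − w) + (2/q)•t × y′`, `q = ‖y − w‖² − ⟪y − w,t⟫² + a`, `q′ = 2⟪y − w, y′⟫ − 2⟪y − w, t⟫⟪y′, t⟫`. [folklore] -/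
theorem hasDerivAt_lorentzStrand_comp {a : ℝ} (ha : 0 < a) (w t : EuclideanSpace ℝ (Fin 3)) (ht : ‖t‖ = 1)
    {y : ℝ → EuclideanSpace ℝ (Fin 3)} {y' : EuclideanSpace ℝ (Fin 3)} {τ : ℝ} (hy : HasDerivAt y y' τ) :
    HasDerivAt (fun τ' => (2 / (‖y τ' - w‖ ^ 2 - ⟪y τ' - w, t⟫_ℝ ^ 2 + a)) • cross t (y τ' - w))
      ((-(2 * (2 * ⟪y τ - w, y'⟫_ℝ - 2 * ⟪y τ - w, t⟫_ℝ * ⟪y', t⟫_ℝ)) / (‖y τ - w‖ ^ 2 - ⟪y τ - w, t⟫_ℝ ^ 2 + a) ^ 2) •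
          cross t (y τ - w) +
        (2 / (‖y τ - w‖ ^ 2 - ⟪y τ - w, t⟫_ℝ ^ 2 + a)) • cross t y') τ := by
  have hv : HasDerivAt (fun τ' => y τ' - w) y' τ := hy.sub_const w
  have hq : HasDerivAt (fun τ' => ‖y τ' - w‖ ^ 2 - ⟪y τ' - w, t⟫_ℝ ^ 2 + a)
      (2 * ⟪y τ - w, y'⟫_ℝ - 2 * ⟪y τ - w, t⟫_ℝ * ⟪y', t⟫_ℝ) τ := by
    have h1 : HasDerivAt (fun τ' => ‖y τ' - w‖ ^ 2) (2 * ⟪y τ - w, y'⟫_ℝ) τ := hv.norm_sq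
    have h2 : HasDerivAt (fun τ' => ⟪y τ' - w, t⟫_ℝ) ⟪y', t⟫_ℝ τ := by
      have h := hv.inner ℝ (hasDerivAt_const τ t)
      simpa using h
    have h3 : HasDerivAt (fun τ' => ⟪y τ' - w, t⟫_ℝ ^ 2) (2 * ⟪y τ - w, t⟫_ℝ * ⟪y', t⟫_ℝ) τ := by
      have h := h2.mul h2
      refine (h.congr_of_eventuallyEq (Eventually.of_forall fun s => ?_)).congr_deriv (by ring)
      simp only [Pi.mul_apply, pow_two]
    have h := (h1.sub h3).add_const a
    exact h
  have hqpos : 0 < ‖y τ - w‖ ^ 2 - ⟪y τ - w, t⟫_ℝ ^ 2 + a := lorentzStrand_pos ha t _ ht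
  have hinv : HasDerivAt (fun τ' => 2 / (‖y τ' - w‖ ^ 2 - ⟪y τ' - w, t⟫_ℝ ^ 2 + a))
      (-(2 * (2 * ⟪y τ - w, y'⟫_ℝ - 2 * ⟪y τ - w, t⟫_ℝ * ⟪y', t⟫_ℝ)) / (‖y τ - w‖ ^ 2 - ⟪y τ - w, t⟫_ℝ ^ 2 + a) ^ 2) τ := by
    have h := (hasDerivAt_const τ (2:ℝ)).div hq hqpos.ne'
    refine h.congr_deriv ?_
    ring
  have hcross : HasDerivAt (fun τ' => cross t (y τ' - w)) (cross t y') τ :=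
    (crossCLM t).hasFDerivAt.comp_hasDerivAt τ hv
  have h := hinv.smul hcross
  refine h.congr_deriv ?_
  abel

/-- **The datum-line strand integral along a differentiable point path**: it IS the Lorentzian (`lineBiotSavart_core`), hence has the explicit
derivative of `hasDerivAt_lorentzStrand_comp`. [folklore] -/
theorem hasDerivAt_datumStrand_comp {N : ℕ} (Γ : ℝ) (p t : Fin N → EuclideanSpace ℝ (Fin 3)) (s₀ : Fin N → ℝ) (ht : ∀ k, ‖t k‖ = 1)
    (k : Fin N) {y : ℝ → EuclideanSpace ℝ (Fin 3)} {y' : EuclideanSpace ℝ (Fin 3)} {τ : ℝ} (hy : HasDerivAt y y' τ) :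
    HasDerivAt (fun τ' => ∫ σ : ℝ, ((‖y τ' - datumLine Γ p t s₀ k σ‖ ^ 2 +
          Real.exp (-(1+Real.eulerMascheroniConstant-Real.log 2)) * (1:ℝ)) ^ (3 / 2 : ℝ))⁻¹ • cross (t k) (y τ' - datumLine Γ p t s₀ k σ))
      ((-(2 * (2 * ⟪y τ - waistPt Γ p t s₀ k, y'⟫_ℝ - 2 * ⟪y τ - waistPt Γ p t s₀ k, t k⟫_ℝ * ⟪y', t k⟫_ℝ)) /
            (‖y τ - waistPt Γ p t s₀ k‖ ^ 2 - ⟪y τ - waistPt Γ p t s₀ k, t k⟫_ℝ ^ 2 +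
              Real.exp (-(1+Real.eulerMascheroniConstant-Real.log 2)) * (1:ℝ)) ^ 2) • cross (t k) (y τ - waistPt Γ p t s₀ k) +
        (2 / (‖y τ - waistPt Γ p t s₀ k‖ ^ 2 - ⟪y τ - waistPt Γ p t s₀ k, t k⟫_ℝ ^ 2 +
            Real.exp (-(1+Real.eulerMascheroniConstant-Real.log 2)) * (1:ℝ))) • cross (t k) y') τ := by
  have hfun : (fun τ' => ∫ σ : ℝ, ((‖y τ' - datumLine Γ p t s₀ k σ‖ ^ 2 +
          Real.exp (-(1+Real.eulerMascheroniConstant-Real.log 2)) * (1:ℝ)) ^ (3 / 2 : ℝ))⁻¹ • cross (t k) (y τ' - datumLine Γ p t s₀ k σ)) =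
      fun τ' => (2 / (‖y τ' - waistPt Γ p t s₀ k‖ ^ 2 - ⟪y τ' - waistPt Γ p t s₀ k, t k⟫_ℝ ^ 2 +
          Real.exp (-(1+Real.eulerMascheroniConstant-Real.log 2)) * (1:ℝ))) • cross (t k) (y τ' - waistPt Γ p t s₀ k) := by
    funext τ'
    exact (lineBiotSavart_core coreConst_pos (waistPt Γ p t s₀ k) (t k) (y τ') (ht k)).2
  rw [hfun]
  exact hasDerivAt_lorentzStrand_comp coreConst_pos (waistPt Γ p t s₀ k) (t k) (ht k) hy

end Summit.NavierStokesRegularity.NavierStokesRegularity.Theorems.SkeletonJ1RFrame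

end
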